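import Mathlib
import HarnessLib
import HarnessLib.Audit
import Summits.KontsevichZagierPeriods.Statement
import Literature.NumberTheory.EllipticCurves.RealLatticePeriod
import HarnessLib.Audit.Status.Attr

/-!
Route: HodgeLevel

# Route HodgeLevel — level, not only weight — rational integrands in n variables see Hodge level ≤
n−1; the d = 2 rational stratum is curve-type of length ≤ 2, and an elliptic period needs two
rational variables

It suffices to show RATIONAL STRATA: for every d, two KZ-rational integral representations of
dimensions ≤ d with the same value are
KZ-equivalent — the stratification frame by rational dimension that route LowDimension opened for d
≤ 1 (frame statement shared verbatim,
deduplicated by the ledger). This route realises card level-not-only-weight-rational-degree and owns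
the layer d = 2 plus one provable
invariant, both coming from a single structural fact (the LEVEL LEMMA): a rational integrand p/q on
σ ⊂ ℝⁿ lives on a RATIONAL n-fold, so
after embedded resolution every constituent of the mixed Hodge structure Hⁿ(𝔸ⁿ ∖ {q = 0}, ∂σ)
carrying the symbol of r is Tate or a
subquotient of Hᵃ(Y)(−b) with Y smooth projective of dimension ≤ n−1 (residues along the polar and
boundary divisors, blow-up centres of
dimension ≤ n−2): Hodge LEVEL ≤ n−1 on top of the weight box [0, 2n] that all n-dimensional
representations obey. An ALGEBRAIC
(ℚ-semialgebraic) integrand reaches level n (n = 2: K3 and ϖ² = Γ(¼)⁴/(8π) periods), so KZ's remark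
'rational or algebraic gives the same
periods' (tree: `exists_isRational_equivalent`, one extra variable) hides a dimension shift of
exactly one that level detects and weight
does not. For n = 2 the constituents are ℚ(0), ℚ(−1), ℚ(−2), H¹(C), H¹(C)(−1): dimension two is
still about CURVES, of length ≤ 2. Inside
the fixed H21 calculus this becomes four typed statements: DimTwoNormalForm (every 2-dim rational
representation reduces BY MOVES to
constants, 1-dim representations = areas under algebraic arcs = real 1-periods, and
log- /arctan-areas ∫∫ h(x)/y, ∫∫ h(x)/(1+y²) =
∫ h·log g, ∫ h·arctan g), PlanarAreas (depth 1: equal areas of planar ℚ-semialgebraic sets ⇒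
KZ-equivalent — Huber–Wüstholz's 1-period
theorem transferred into the rules), DimTwoRationalStratum (the whole layer, whose remainder after
the two previous items is depth-2
rigidity over curves), and one dimension down the level gap, as SUPPORT relative to one displayed
transcendence instance:
OnePeriodNeedsTwoVariablesOfLogSpan (if Ω₀ ∉ ℚ̄ + Σ ℚ̄·log αᵢ — Wüstholz's theorem, in tree as the
light named fact
`Literature.NumberTheory.Transcendental.ellipticPeriod_not_mem_logSpan`, CM allowed, deliberately
NOT imported — then no 1-dim RATIONAL
representation takes the value γ + β·Ω₀ of the least real elliptic period, although a 1-dim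
algebraic and a 2-dim rational one do —
with supports DimOneRationalValues, OnePeriodInTwoVariables; repair 2026-08-15: the former crux
OnePeriodNeedsTwoVariables, which named
the XL fact `analyticSubgroupTheorem_GaGmE_periods` and dragged 18 unproved facts into the cone, is
dropped). X = RationalStrata; the
cruxes are its d = 2 layer; they do not imply X (sector route, exactly like LowDimension and
HermiteRigidity); every constant of every
item now rests on Mathlib, the Statement's own cone and PROVED tree facts
(RealLatticePeriod/Uniformization, all `_holds`).
Lean: `∀ d : ℕ, ∀ ⦃n m : ℕ⦄, n ≤ d → m ≤ d → ∀ (r :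
Literature.NumberTheory.Transcendental.KZ.IntegralRep n) (r' :
Literature.NumberTheory.Transcendental.KZ.IntegralRep m), r.IsRational → r'.IsRational → r.value =
r'.value → Literature.NumberTheory.Transcendental.KZ.Equivalent r r'`

## Assembly
Pure logic, proved in the folder's Sketch.lean (`assembly_holds`, 3 lines): given the frame,
specialise d := max n m and use
`KontsevichZagierPeriods_iff`. The frame item and this assembly are shared with route LowDimension
(same normalised signatures); the
cruxes are the d = 2 layer of the frame (DimTwoRationalStratum ⇐ DimTwoNormalForm, PlanarAreas,
depth-2 remainder) and the calibration
of the level invariant one dimension down, now support only (OnePeriodNeedsTwoVariablesOfLogSpan ⇐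
DimOneRationalValues by algebra, the
transcendence instance being its displayed hypothesis; OnePeriodInTwoVariables) —
they do not imply the frame (sector route; the deliverable is the certified layer d = 2 and the
first separation of two rational-degree
strata). Deciding theorem (D-0027): `closes (h : RationalStrata) : KontsevichZagierPeriods` (intro;
h (max n m)), certified natively
2026-08-15. Sanity (Sketch.lean): RationalStrata → DimTwoRationalStratum → PlanarAreas by
instantiation; DimOneRationalValues →
OnePeriodNeedsTwoVariablesOfLogSpan (20 lines, rc 0).

Rationale: WHY THIS LINE. The mechanism is standard mixed Hodge theory of hypersurface complements on rational
varieties — Griffiths residues (Griffiths1969), the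
weight spectral sequence of a normal-crossings compactification (DeligneHodgeII1971 §3.2,
DeligneHodgeIII1974 §8.3 for pairs), 'naive
periods are periods of (X, D)' (HuberMullerStach2017 Ch. 12) — pointed at the one distinction inside
KZ's Definition nobody has used: the
literal (rational-integrand) shape versus the algebraic shape; the imported areas are Hodge theory
(the level bound), transcendence of
1-periods (HuberWustholz2022 Thm 9.10/13.3 and the dimension formula Thm 1.4 = Cor. 16.4 / Thm
15.3(1), whose instance for the 1-motive
[ℤ^r → 𝔾ₘ^r] × [0 → E] — 'a non-zero elliptic period is not in ℚ̄ + Σ ℚ̄·log αᵢ', CM allowed — is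
the light tree fact
`Literature.NumberTheory.Transcendental.ellipticPeriod_not_mem_logSpan` (EllipticPeriodLogSpan.lean;
reduced in
EllipticPeriodLogSpanProofs.lean to Philippon's zero estimate `philippon1986_std` for non-CM
lattices, k = 0 = Schneider and ω ∉ ℚ̄π
unconditional), DISPLAYED INLINE as the hypothesis of the calibration support item and not imported;
Masser1975; BakerWustholz2007 §6.2) and real semialgebraic geometry (cylindrical
decomposition, blow-up changes of variables) for the normal form. Wan (arXiv:1102.2273) defined the
degree of a period through VOLUME
representations, proved only sub-additivity and the one-variable form 'a·arctan ξ + b·log η + c'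
(his Thm 4.1 = our support
DimOneRationalValues), and left 'exhibit a period of degree ≥ 3' and 'describe all periods of degree
2' open (Problems 1, 3); the level
lemma answers the RATIONAL-degree analogues one step up: deg^rat(Ω₀) = 2 exactly (supports
OnePeriodNeedsTwoVariablesOfLogSpan +
OnePeriodInTwoVariables, modulo the displayed Wüstholz instance) while deg^rat(π) =
deg^rat(log 2) = 1, and 'all values of 2-dim rational representations' = curve-type of length ≤ 2
(crux 3). What no prior route does:
LowDimension stops at d ≤ 1 and defers 'd ≤ 2 (needs GPC-type input)'; HermiteRigidity and
HyperbolicBloch derive relations inside chosen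
depth-1 elliptic and genus-0 dilogarithm sectors; this route states the whole d = 2 rational layer,
proves (as items) that nothing of
surface type can occur in it, converts 'needs GPC-type input' into a finite list (Huber–Wüstholz at
depth 1; at depth 2 only LINEAR
independence of dilogarithm/Clausen/L(2,χ)/elliptic-dilogarithm values, cf. Milnor1982,
CalegariDimitrovTang2024), and supplies the first
theorem separating two rational-degree strata. Negatives index: empty (0 refuted statements, checked
2026-08-15).

RANKED CRUXES. #0 RationalStrata (target) — for every d, any two KZ-rational integral
representations of dimensions ≤ d with equal value are KZ-equivalent (intermediate representations
of any dimension allowed) — the stratification frame by rational dimension, verbatim LowDimension's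
`LowdimThesis` (deduplicated; this route owns the layer d = 2 and the level-gap calibration). (why
it might fail: it is the summit re-indexed by rational dimension: from d = 3 on (ζ(3), MZVs, K3 and
abelian-surface periods) it needs Grothendieck-strength rigidity; this route claims only the layer d
= 2 and the level-gap theorems.) [KontsevichZagier2001, HuberMullerStach2017]
#2 DimTwoRationalStratum (crux) — the layer d = 2 of the frame: any two KZ-rational representations
of dimensions ≤ 2 (a rational function p/q over a ℚ-semialgebraic subset of ℝ⁰, ℝ¹ or ℝ²) with equal
value are KZ-equivalent. By the level lemma its values are periods of curve-type motives of length ≤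
2 (ℚ(0), ℚ(−1), ℚ(−2), H¹(C), H¹(C)(−1) constituents): 1-periods (areas under algebraic arcs), their
2πi-twists, and length-2 iterated integrals on curves (∫ h log g, ∫ h arctan g: Li₂/Clausen/L(2,χ)
at genus 0, elliptic dilogarithms at genus ≥ 1) — no ζ(3), no π³, no ϖ², no K3 period. Card items
(B)(i)–(iv); contains LowDimension's d ≤ 1 (Baker) and PlanarAreas. [deps: DimTwoNormalForm,
PlanarAreas] [difficulty: open-problem] (why it might fail: contains depth-2 rigidity over curves —
ℚ̄-linear independence of 1, π², Li₂/Clausen values at algebraic points, L(2,χ), elliptic dilogs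
(Milnor's Lobachevsky conjecture inside; GPC-strength though linear) — AND five-term/Fay identities
as moves; either half can fail for the fixed calculus.) [KontsevichZagier2001, HuberWustholz2022,
Milnor1982, CalegariDimitrovTang2024]
#3 DimTwoNormalForm (crux) — the level lemma inside the calculus (card (B)(i) 'NoLevelTwo', typed):
every 2-dim KZ-rational representation r is congruent modulo KZ.relations to a ℤ-combination of (a)
0-dim representations (real algebraic constants), (b) 1-dim representations (semialgebraic
integrands of one variable = areas under algebraic arcs = real 1-periods), (c) LOG-AREAS [S ⊆ {y >
0}, h(x)/y] (value ∫ h(x)·Σ±log gᵢ(x) dx) and (d) ARCTAN-AREAS [S, h(x)/(1+y²)] (value ∫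
h(x)·Σ±arctan gᵢ(x) dx). Plan: cylindrical decomposition of σ (rule 1a; null cells are relations),
partial fractions of p/q in the fibre variable over the algebraic functions of the base (rule 1b),
Newton–Leibniz with the RATIONAL part of the primitive (semialgebraic, rule 3) for poles of order ≥
2 and polynomial parts, shears y ↦ y − β(x), y ↦ (y−u(x))/v(x), y ↦ (y−u)²+v² (rule 2) to bring
simple real poles and conjugate pairs to the shapes (c), (d); log-areas over a common base merge by
the fibrewise dilation y ↦ g₁(x)·y (multiplicativity of log as two moves). [difficulty: L] (why it
might fail: partial fractions along a fibre are not termwise absolutely integrable where poles of q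
collide on ∂σ (1/(y²−x³) at the cusp: coefficients ~ x^(−3/2)); the chain must dodge via another
projection or blow-up CoV — a configuration defeating all of them is a d = 2 regularisation
witness.) [KontsevichZagier2001, arXiv:1102.2273, ViuSos2021, BasuPollackRoy2006,
DeligneHodgeII1971]
#4 PlanarAreas (crux) — curved planar Hilbert III over ℚ̄ inside the rules (card (B)(ii), depth 1 of
the layer): two 2-dim representations with integrand 1 — i.e. two ℚ-semialgebraic planar sets of
finite area — with the same area are KZ-equivalent. Areas of planar ℚ-semialgebraic sets are exactly
the (ℚ̄∩ℝ)-combinations of real 1-periods ∫ (ψ − φ) dx over algebraic arcs (Newton–Leibniz along y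
with primitive y, and back by subgraphs), so this is Huber–Wüstholz's theorem 'all ℚ̄-linear
relations among 1-periods come from bilinearity and functoriality of pairs (C, D)' (Thm 13.3)
TRANSFERRED: every such relation — isogenies and correspondences between curves, Cauchy/residue
relations among real ovals, exact algebraic forms — must be a chain of real semialgebraic moves.
Equality of two such areas is decidable today (SertozOuaknineWorrell2025); the claim is that it is
derivable. Shares its 1-dim content with LowDimension items 0117/0510 (informal, definition-blocked)
and its elliptic sectors with HermiteRigidity. [difficulty: XL] (why it might fail: Huber–Wüstholz
relations among 1-periods come from isogenies/correspondences and Cauchy residues; each must be a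
chain of REAL semialgebraic moves (HermiteRigidity's genus-2 three-oval identity is the first forced
Stokes detour) — one underivable identity refutes it and the summit.) [HuberWustholz2022,
SertozOuaknineWorrell2025, Masser1975, KontsevichZagier2001]
#9 OnePeriodNeedsTwoVariablesOfLogSpan (support; replaces the dropped crux #5
OnePeriodNeedsTwoVariables, repair 2026-08-15) — the level gap, value form, RELATIVE to one
displayed transcendence instance: for a real lattice L (Mathlib `PeriodPair`, `IsReal`) whose least
positive real period Ω₀ = L.minRealPeriod is not of the form β₀ + Σ βᵢ yᵢ with β's algebraic and exp
yᵢ algebraic (hypothesis; = the light tree fact `ellipticPeriod_not_mem_logSpan` at ω = Ω₀ whenever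
g₂, g₃ ∈ ℚ̄, CM or not — HuberWustholz2022 Thm 15.3(1), Wüstholz 1989, BakerWustholz2007 §6.1–6.2),
and real algebraic β ≠ 0, γ, NO one-dimensional KZ-rational representation has value γ + β·Ω₀. With
OnePeriodInTwoVariables (Ω₀/2 IS a 2-dim rational value) this is deg^alg(Ω₀) = 1 < deg^rat(Ω₀) = 2.
Proof: DimOneRationalValues puts the value in ℚ̄ + Σ ℚ̄·yᵢ; solve for Ω₀ = (β₀ − γ)/β + Σ (βᵢ/β) yᵢ
(ℚ̄ is a field: `IsAlgebraic.sub/.mul/.inv`, `isAlgebraic_algebraMap_iff` for ℝ → ℂ); contradiction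
— done in the folder's Sketch.lean (rc 0, 20 lines). Why the old crux went: it named
`analyticSubgroupTheorem_GaGmE_periods` (XL, unproved, ¬CM only) and `PeriodPair.HasCM`, importing
AnalyticSubgroupElliptic → OnePeriods/BakerLogarithms/PeriodsWave0 = 18 unproved facts in the cone
and no provers (staffing rule 2026-08-15); the transcendence input is exactly one instance, so it is
displayed, and its discharge is Literature business (needs-fact: none for the items;
`ellipticPeriod_not_mem_logSpan` only for the unconditional corollary). [deps: DimOneRationalValues]
[difficulty: provable-now] [HuberWustholz2022, BakerWustholz2007, arXiv:1102.2273]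
#9 DimOneRationalValues (support) — level 0 in dimension 1 (Wan's Thm 4.1 made precise; LowDimension
0405 steps (i)–(iii) without the moves): the value of a 1-dim KZ-rational representation is a
ℚ̄-linear combination of 1 and logarithms of non-zero algebraic numbers — a ℚ-semialgebraic subset
of ℝ is a finite union of points and intervals with real algebraic endpoints, partial fractions over
ℚ̄, ∫ dx/(x−a) = log, arctan c = (1/2i)·Log((1+ic)/(1−ic)), improper ends converge only when the log
terms cancel. [difficulty: provable-now] [arXiv:1102.2273, Baker1975, KontsevichZagier2001]
#9 OnePeriodInTwoVariables (support) — existence side of the gap: for a real lattice with rational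
invariants q₂, q₃ and positive discriminant, Ω₀/2 is the value of a 2-dim KZ-RATIONAL representation
— integrand 1 over {(x, y) | f(x) > 0, x left of the largest root, 0 < y, y²·f(x) < 1}, f = 4x³ −
q₂x − q₃ (ℚ-semialgebraic; the largest-root condition is '∃ t > x, f t < 0', legal by the proved
Tarski–Seidenberg) — by Newton–Leibniz/Fubini and the PROVED tree fact
`PeriodPair.IsReal.integral_inv_sqrt_cubic_of_discr_pos_holds` (∫_{e₃}^{e₂} f^{−1/2} = Ω₀/2).
[difficulty: provable-now] [Lawden1989, KontsevichZagier2001]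

TWO-LAYER PLAN. Foreseen glued splits (k ≤ 3, depth 1), filed only after a crux closes:
DimTwoRationalStratum ⇐ DimTwoNormalForm → PlanarAreas →
LogAreaCompleteness → DimTwoRationalStratum, where LogAreaCompleteness (new child) = kernel form on
the log- /arctan-area sector = depth-2
TRANSFER (five-term, distribution and inversion as moves at genus 0 — HyperbolicBloch's items; Fay /
one elliptic Stokes cell at genus 1;
residue and Gysin chains for the mixed curve/Tate pieces) under the named hypothesis Depth2Rigidity
(a `def … : Prop` listing the linear
independence inputs: Bloch–Wigner/Rogers values at algebraic arguments, 1, ζ(2), L(2,χ), Catalan,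
elliptic dilogarithms vs ω, η, π).
DimTwoNormalForm ⇐ CellReduction (cylindrical decomposition + partial fractions on cells in general
position, incl. the blow-up dodge) →
FibrewiseLogMerge (log-areas over a common base merge by y ↦ g(x)·y and rule 1a) → DimTwoNormalForm.
No split foreseen for the supports:
OnePeriodNeedsTwoVariablesOfLogSpan ⇐ DimOneRationalValues is 20 lines of algebra (Sketch.lean).

KILL CRITERIA. (1) A 2-dim RATIONAL representation whose value is numerically (60 digits, PSLQ) c·ϖ²
= c·Γ(¼)⁴/(8π), c·ζ(3), c·π³, c·π²log 2 or any
(2,0)-period of a K3/abelian surface refutes the level lemma's reading (or GPC): close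
`refuted:DimTwoNormalForm` if the witness also
defeats the normal form, else record a GPC anomaly and pivot the thesis to the normal form alone.
(2) ¬DimTwoNormalForm by an explicit
representation every projection/blow-up chain of which has a divergent intermediate: the layer d = 2
inherits route Neg's regularisation
obstruction — pivot to 'normal form up to StandardParts' SpArcClosure' or close
`refuted:DimTwoNormalForm`. (3) ¬PlanarAreas (an
equal-area pair not connected by moves, e.g. HermiteRigidity's genus-2 oval relation proved
underivable) refutes the H21 reading of
Conjecture 1 itself — close `refuted:PlanarAreas` and hand the witness to route Neg / the operator.
(4) ¬OnePeriodNeedsTwoVariablesOfLogSpan can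
only come from a defect in DimOneRationalValues (a 1-dim rational value outside the Baker span) —
that would falsify Wan's Thm 4.1 and
LowDimension's crux 0405 plan at once; treat as a calculus/normal-form bug first. Mooted:
LowdimThesis proved for all d elsewhere (the summit).

NOT DECOMPOSED YET. Depth-2 transfer and rigidity (LogAreaCompleteness, Depth2Rigidity) —
deliberately not filed until DimTwoNormalForm or PlanarAreas
closes (D-0019: children later); the DISCHARGE of the displayed transcendence hypothesis of
OnePeriodNeedsTwoVariablesOfLogSpan — it is the
light named fact `Literature.NumberTheory.Transcendental.ellipticPeriod_not_mem_logSpan` (CM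
allowed; in tree, unproved as a whole:
non-CM reduced to `philippon1986_std`, CM to the one-factor zero estimate, k = 0 and ω ∉ ℚ̄π
proved), deliberately outside this route's
cone; the corollary modulo the fact alone, `(h : ellipticPeriod_not_mem_logSpan) →` (CM or not, g₂
g₃ ∈ ℚ̄) no 1-dim rational representation
reaches γ + β·Ω₀, is a 5-line Theorems file any prover may land with `--supports
OnePeriodNeedsTwoVariablesOfLogSpan`, never an item (needs-fact recorded: none of the 18 listed cone
facts is
needed by any item; import `Literature.NumberTheory.Transcendental.AnalyticSubgroupElliptic`
dropped, `RealLatticePeriod` kept — its four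
facts and Uniformization's two all have `_holds`); the general RationalDegreeBound deg^rat_KZ(r) ≥
max(co-level, level + 1)
(needs 'moves are morphisms of motives' Ψ, shared with card kz-degree-hodge-colevel-problem-two, and
Nori vocabulary); the motivic level
lemma itself for all n (informal support item + definition request, below); the d = 3 predictions
(surfaces allowed, threefold (3,0)
excluded: deg^rat(Fermat-quintic period) = 4); mixed pairs of dimensions (1, 2) inside the layer are
covered by the crux as stated and need
no separate item.

CHEAPEST FALSIFIER. Run the collision-census engine (card collision-census) restricted to 2-dim
RATIONAL representations of small height (deg p, deg q ≤ 4,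
box/disc/simplex domains with coefficients ≤ 5) against the FORBIDDEN basis {ϖ² = 6.8751858180…,
ζ(3), π³, π² log 2, ζ(2) log 2,
Γ(⅓)⁶/π²} and the ALLOWED basis {1, π, π², log 2, log 3, Catalan, Li₂(½), L(2,χ₋₃), πϖ/√2 =
5.8247473854…, Ω₀-values}: one 60-digit hit
in the forbidden list kills the level reading. Done by hand here (consistency, refuter-16 and this
session): ∫∫_{ℝ²} dxdy/(1+x⁴+y⁴) =
Γ(¼)²√π/4 = πϖ/√2 (level 1, allowed — the twist of a 1-period), Wan's η: ∫∫_{x²+y²≤1}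
4dxdy/((x²+y²)²+1) = π² (Tate, allowed),
ζ(2) = ∫∫_{[0,1]²} dxdy/(1−xy) (allowed). For crux 3 the cheapest attack is symbolic: take r =
[{0<x<1, 2√x<y<1}, 1/(y²−x³)] and check
that partial fractions in x (not y) give termwise integrable pieces (they do: coefficients
1/(3y^{4/3}), inner integrals O(y^{4/3})); then
search for a polar curve with a singular point on ∂σ that defeats both projections and the blow-up
(x, y) ↦ (x, xy).

NUMBERS. ϖ = 2∫₀¹ dt/√(1−t⁴) = Γ(¼)²/(2√(2π)) = 2.6220575543; ϖ² = Γ(¼)⁴/(8π) = 6.8751858180 (level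
2: predicted deg^rat = 3, deg^alg = 2);
∫∫_{ℝ²} dxdy/(1+x⁴+y⁴) = πϖ/√2 = 5.8247473854 (level 1, a 2-dim rational value). Test curve for crux
5 / support: y² = 4x³ − 28x + 24
(roots −3, 1, 2; g₂ = 28, g₃ = −24, g₂³ − 27g₃² = 6400 > 0, j = 1728·28³/6400 = 5927.04 ∉ ℤ ⇒ no
CM): Ω₀/2 = ∫_{−3}^{1} dx/√f =
∫₀^{π/2} dφ/√(1 + 4cos²φ) = 1.0094529100. Rational degrees: deg^rat(π) = 1 (∫_ℝ dx/(1+x²)),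
deg^rat(log 2) = 1, deg^rat(Ω₀) = 2 (supports,
modulo the displayed Wüstholz instance), deg^rat(ζ(2)) = 2, deg^rat(ζ(3)) = 3 expected (weight 6),
deg^rat(ϖ²) = 3 expected (level 2). Huber–Wüstholz dimension formula
(Thm 1.4): δ(M) = δ_Ta + δ_2 + δ_alg + δ_3 + δ_inc2 + δ_inc3, δ_2(E) = 4 (non-CM), 2 (CM). Items at
open: 8 (4 cruxes); after the cone repair of 2026-08-15: 9 (3 cruxes: DimTwoRationalStratum,
DimTwoNormalForm, PlanarAreas;
target, assembly, 4 supports incl. the informal level lemma), imports = RealLatticePeriod only,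
deciding theorem `closes (h : RationalStrata)`.

DEFINITION REQUESTS. (1) notion `MixedHodgeStructureOfPair` (topic
Literature/AlgebraicGeometry/Motives): the functorial ℚ-mixed Hodge structure on
Hⁿ(X(ℂ), D(ℂ); ℚ) for pairs of varieties over ℚ̄ ⊂ ℂ (DeligneHodgeIII1974 §8.3), with Hodge numbers
of Gr^W and `level` = max |p − q|
(the tree has pure `HodgeStructure.level` only) — needed to type the level lemma. (2) Informal
support item filed after open:
`RationalRepsLevelBound` — for r : KZ.IntegralRep n with r.IsRational, every Gr^W-constituent of
Hⁿ(𝔸ⁿ ∖ {q = 0} ∪ walls, ∂σ-configuration)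
carrying [r] is a subquotient of Hᵃ(Y)(−b), Y smooth projective over ℚ̄ of dimension ≤ n − 1, or
Tate; hence level ≤ n − 1 (n = 2:
curve type). (3) The light cite fact requested at the first repair attempt (wi-16003) has LANDED as
`Literature.NumberTheory.Transcendental.ellipticPeriod_not_mem_logSpan`
(CM allowed; Masser's CM Theorem III is proved in tree as `masser_ellipticPeriods_cm_holds`);
nothing further is wanted — it is displayed, not imported.

Novelty: Searches (2026-08-15): `lit search "degrees of periods" Wan --source zbmath` (2 hits:
arXiv:1102.2273 Wan 2011; arXiv:1509.01097 =
ViuSos2021) — Wan READ in full (10 pp.: Def. 3.1 degree via volumes, Prop. 3.2/3.4, Thm 4.1,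
Problems 1–3 open, Thm 5.2); `lit read
book:huber2022-transcendence-linear-relations-1-periods --grep 'Theorem 9.10|13.3|…'` (51 hits; pp.
18–20 READ: Thm 1.2 = 13.3, Thm 1.3
= 9.10, Thm 1.4 dimension formula with the direct-sum decomposition used by crux 5); `lit vsearch
"Hodge level of the cohomology of the
complement of a hypersurface in a rational variety …"` (8 books: Cattani–El Zein–Griffiths 2014,
Carlson–Müller-Stach–Peters 2003/2017,
Dimca 1992 Ch. 6, Voisin 2002 — textbook status of the lemma's inputs, none mentions KZ
representations); `lit frontier
KontsevichZagierPeriods --since 2020` (30 rows: arXiv:2303.05030 GPC for Kummer surfaces,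
arXiv:2302.07650 arithmetic of periods of
rational forms — nothing on rational-vs-algebraic degree or level of representations); `lit search …
--source arxiv` and `lit galaxy
search "degree of a period" --star all` FAILED this session (arXiv HTTP 429; galaxyd queue > 90 s) —
recorded, not retried endlessly; hub
side: all 21 route files under Theses/ and the 118-card index read (`ledger idea list`): nearest
in-hub = card
kz-degree-hodge-colevel-problem-two (CO-level, unrouted), routes LowDimension (d ≤ 1),
HermiteRigidity (depth-1 elliptic sectors),
HyperbolicBloch (genus-0 depth 2).
Nearest prior art found: arXi  [refs: 1102.2273, 1509.01097, 2303.05030, 2302.07650, book:huber2022-transcendence-linear-relations-1-periods, ViuSos2021, HuberWustholz2022]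

Barriers (technique_class: hodge-level-bound; sector-decomposition): - technique_class: hodge-level-bound; sector-decomposition
- Literature.Barriers.KontsevichZagierPeriods.noSemialgebraicPrimitive_inv_sub_two: respected and
made structural — DimTwoNormalForm never integrates OUT a variable with a transcendental primitive:
rule 3 is used only with the rational part of a partial-fraction primitive (semialgebraic), while
the log/arctan layers are KEPT as 2-dim log- /arctan-area representations (the barrier is exactly why
the normal form has length 2 and not 1); crux 5 evaluates values outside the calculus, where
primitives may be transcendental.
- Literature.Barriers.KontsevichZagierPeriods.kzConjecture_implies_ellipticPeriods_algIndep: not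
engaged — every transcendence input is LINEAR (Huber–Wüstholz / the analytic subgroup theorem
instance; Depth2Rigidity is linear independence), never algebraic independence of ω, η; ϖ² enters
only as a forbidden VALUE in the census, not as something to prove transcendental.
- Literature.Barriers.KontsevichZagierPeriods.kzConjecture_implies_twoPiI_log_algIndep: same remark
for the genus-0 part (Baker's linear theorem, proved in tree, inside
DimOneRationalValues/LowDimension).
- Literature.Barriers.KontsevichZagierPeriods.kzConjecture_implies_oddZetaAlgIndep: evaded by the
level/weight box itself — ζ(3) has weight 6 > 4 and cannot be a value in the layer d = 2; the
barrier bites from d = 3 on, which the route does not claim.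
- Literature.Barriers.KontsevichZagierPeriods.not_complete_of_undecidable: consistent —

Novelty grade: new-combination — ROUTE REVIEW (refuter rreview-5065e3d8, 08-15). Grade provisional = planner's new-combination, endorsed on reading: (Hodge-level bound for complements of plane curves on rational n-folds — Griffiths residues, Deligne weight spectral sequence) + (KZ rational-vs-algebraic shape / Wan 2011 degree, Prob (refuter refuter-rreview-route-CriticalPhenomena--5065e3d8-0, 2026-08-15T14:01:43Z; prior: arXiv:1102.2273, HuberWustholz2022, DeligneHodgeII1971, Griffiths1969, HuberMullerStach2017, KontsevichZagier2001)

History (route lifecycle, newest last):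
- 2026-08-15T16:20:23Z · rev 1: dropped OnePeriodNeedsTwoVariables — route-repair (cone + glue): drop import Literature.NumberTheory.Transcendental.AnalyticSubgroupElliptic (all 16/18 listed unproved cone facts ride in on it: One (planner-rbadge-KontsevichZagierPeriods-HodgeLe-0777adc4-g4-0)
- 2026-08-16T04:08:32Z · AUTO-CRUX (backfill): RationalStrata — hypotheses of the deciding theorem that nothing in the route derives are cruxes (operator:999:1085951)
- 2026-08-23T22:58:18Z · DORMANT — reconciler: no traction for 6.3 d (last activity item-evidence-added at 2026-08-17T14:47:04Z); parked, not closed — `ledger route dormant route-KontsevichZagier (operator:999:532704)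
- 2026-08-30T02:50:01Z · REACTIVATED — reconciler: reactivated — activity statement-attached at 2026-08-30T02:02:28Z after parking at 2026-08-23T22:58:18Z (operator:999:1199120)

sub-problem: KontsevichZagierPeriods · status: open · opened planner-plancard-KontsevichZagierPeriods-Kont-4376d775-0 2026-08-15T11:38:51Z · rev 1 · ledger route-KontsevichZagierPeriods-HodgeLevel
GENERATED by the gate from the ledger (D-0016/17). Provers cite these decls: `theorem foo : Summit.KontsevichZagierPeriods.KontsevichZagierPeriods.Theses.HodgeLevel.<Decl> := …` in Summits/KontsevichZagierPeriods/KontsevichZagierPeriods/Theorems/<Name>.lean.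
-/

namespace Summit.KontsevichZagierPeriods.KontsevichZagierPeriods.Theses.HodgeLevel

open scoped BigOperators Topology Manifold Classical MeasureTheory ProbabilityTheory Matrix InnerProductSpace ComplexConjugate ContinuousMap
open Filter Set Function TopologicalSpace MeasureTheory

attribute [summit_statement] _root_.KontsevichZagierPeriods

open Literature Periods

/-- item stmt-KontsevichZagierPeriods-0096 · crux (kind.auto-crux: conjecture-grade) · rank 0 · open · by planner
why it might fail: it is the summit re-indexed by rational dimension: from d = 3 on (ζ(3), MZVs, K3 and abelian-surface periods) it needs Grothendieck-strength rigidity; this route claims only the layer d = 2 and the level-gap theorems.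
sources: KontsevichZagier2001, HuberMullerStach2017
Thesis X: for every d, any two KZ-rational integral representations of dimensions ≤ d with equal
value are equivalent under the H21 KZ calculus (intermediate representations of any dimension
allowed). Trivially equivalent to the statement; the route is the stratification: d ≤ 1 via Baker
(crux #2), d = 1 semialgebraic via Huber–Wüstholz (crux #3), higher d deferred. -/
@[route_item "route-KontsevichZagierPeriods-HodgeLevel", crux]
def RationalStrata : Prop :=
  ∀ d : ℕ, ∀ ⦃n m : ℕ⦄, n ≤ d → m ≤ d → ∀ (r : Literature.NumberTheory.Transcendental.KZ.IntegralRep n) (r' : Literature.NumberTheory.Transcendental.KZ.IntegralRep m), r.IsRational → r'.IsRational → r.value = r'.value → Literature.NumberTheory.Transcendental.KZ.Equivalent r r'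

/-- item stmt-KontsevichZagierPeriods-4280 · aside · rank 2 · open · by planner
why it might fail: contains depth-2 rigidity over curves — ℚ̄-linear independence of 1, π², Li₂/Clausen values at algebraic points, L(2,χ), elliptic dilogs (Milnor's Lobachevsky conjecture inside; GPC-strength though linear) — AND five-term/Fay identities as moves; either half can fail for the fixed calculus.
sources: KontsevichZagier2001, HuberWustholz2022, Milnor1982, CalegariDimitrovTang2024
[target] the dimension-two stratum: for n, m ≤ 2, KZ-rational reps r : IntegralRep n, r' :
IntegralRep m with equal value are KZ-equivalent. -/
@[route_item "route-KontsevichZagierPeriods-HodgeLevel"]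
def DimTwoRationalStratum : Prop :=
  ∀ ⦃n m : ℕ⦄, n ≤ 2 → m ≤ 2 → ∀ (r : Literature.NumberTheory.Transcendental.KZ.IntegralRep n) (r' : Literature.NumberTheory.Transcendental.KZ.IntegralRep m), r.IsRational → r'.IsRational → r.value = r'.value → Literature.NumberTheory.Transcendental.KZ.Equivalent r r'

/-- item stmt-KontsevichZagierPeriods-4989 · aside · rank 3 · open · by planner
why it might fail: partial fractions along a fibre are not termwise absolutely integrable where poles of q collide on ∂σ (1/(y²−x³) at the cusp: coefficients ~ x^(−3/2)); the chain must dodge via another projection or blow-up CoV — a configuration defeating all of them is a d = 2 regularisation witness.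
sources: KontsevichZagier2001, arXiv:1102.2273, ViuSos2021, BasuPollackRoy2006, DeligneHodgeII1971
[crux] the level lemma inside the calculus (card (B)(i) 'NoLevelTwo', typed): every 2-dim
KZ-rational representation r is congruent modulo KZ.relations to a ℤ-combination of (a) 0-dim
representations (real algebraic constants), (b) 1-dim representations (semialgebraic integrands of
one variable = areas under algebraic arcs = real 1-periods), (c) LOG-AREAS [S ⊆ {y > 0}, h(x)/y]
(value ∫ h(x)·Σ±log gᵢ(x) dx) and (d) ARCTAN-AREAS [S, h(x)/(1+y²)] (value ∫ h(x)·Σ±arctan gᵢ(x)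
dx). Plan: cylindrical decomposition of σ (rule 1a; null cells are relations), partial fractions of
p/q in the fibre variable over the algebraic functions of the base (rule 1b), Newton–Leibniz with
the RATIONAL part of the primitive (semialgebraic, rule 3) for poles of order ≥ 2 and polynomial
parts, shears y ↦ y − β(x), y ↦ (y−u(x))/v(x), y ↦ (y−u)²+v² (rule 2) to bring simple real poles and
conjugate pairs to the shapes (c), (d); log-areas over a common base merge by the fibrewise dilation
y ↦ g₁(x)·y (multiplicativity of log as two moves). [difficulty: L] -/
@[route_item "route-KontsevichZagierPeriods-HodgeLevel"]
def DimTwoNormalForm : Prop :=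
  ∀ (r : Literature.NumberTheory.Transcendental.KZ.IntegralRep 2), r.IsRational → ∃ x ∈ AddSubgroup.closure ({c : Literature.NumberTheory.Transcendental.KZ.FormalRep | ∃ (s : Literature.NumberTheory.Transcendental.KZ.IntegralRep 0), c = Literature.NumberTheory.Transcendental.KZ.of s} ∪ {c | ∃ (s : Literature.NumberTheory.Transcendental.KZ.IntegralRep 1), c = Literature.NumberTheory.Transcendental.KZ.of s} ∪ {c | ∃ (s : Literature.NumberTheory.Transcendental.KZ.IntegralRep 2) (h : ℝ → ℝ), s.domain ⊆ {p | 0 < p 1} ∧ Set.EqOn s.integrand (fun p => h (p 0) / p 1) s.domain ∧ c = Literature.NumberTheory.Transcendental.KZ.of s} ∪ {c | ∃ (s : Literature.NumberTheory.Transcendental.KZ.IntegralRep 2) (h : ℝ → ℝ), Set.EqOn s.integrand (fun p => h (p 0) / (1 + (p 1) ^ 2)) s.domain ∧ c = Literature.NumberTheory.Transcendental.KZ.of s}), Literature.NumberTheory.Transcendental.KZ.of r - x ∈ Literature.NumberTheory.Transcendental.KZ.relations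

/-- item stmt-KontsevichZagierPeriods-4990 · aside · rank 4 · open · by planner
why it might fail: Huber–Wüstholz relations among 1-periods come from isogenies/correspondences and Cauchy residues; each must be a chain of REAL semialgebraic moves (HermiteRigidity's genus-2 three-oval identity is the first forced Stokes detour) — one underivable identity refutes it and the summit.
sources: HuberWustholz2022, SertozOuaknineWorrell2025, Masser1975, KontsevichZagier2001
[crux] curved planar Hilbert III over ℚ̄ inside the rules (card (B)(ii), depth 1 of the layer): two
2-dim representations with integrand 1 — i.e. two ℚ-semialgebraic planar sets of finite area — with
the same area are KZ-equivalent. Areas of planar ℚ-semialgebraic sets are exactly the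
(ℚ̄∩ℝ)-combinations of real 1-periods ∫ (ψ − φ) dx over algebraic arcs (Newton–Leibniz along y with
primitive y, and back by subgraphs), so this is Huber–Wüstholz's theorem 'all ℚ̄-linear relations
among 1-periods come from bilinearity and functoriality of pairs (C, D)' (Thm 13.3) TRANSFERRED:
every such relation — isogenies and correspondences between curves, Cauchy/residue relations among
real ovals, exact algebraic forms — must be a chain of real semialgebraic moves. Equality of two
such areas is decidable today (SertozOuaknineWorrell2025); the claim is that it is derivable. Shares
its 1-dim content with LowDimension items 0117/0510 (informal, definition-blocked) and its elliptic
sectors with HermiteRigidity. [difficulty: XL] -/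
@[route_item "route-KontsevichZagierPeriods-HodgeLevel", crux]
def PlanarAreas : Prop :=
  ∀ (r r' : Literature.NumberTheory.Transcendental.KZ.IntegralRep 2), (∀ p ∈ r.domain, r.integrand p = 1) → (∀ p ∈ r'.domain, r'.integrand p = 1) → r.value = r'.value → Literature.NumberTheory.Transcendental.KZ.Equivalent r r'

/-- item stmt-KontsevichZagierPeriods-10653 · support · rank 9 · closed · proved by Summit.KontsevichZagierPeriods.HodgeLevel.OnePeriodNeedsTwoVariablesOfLogSpan.onePeriodNeedsTwoVariablesOfLogSpan_proof @ 2210f89f96f8 (prover) · by planner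
sources: HuberWustholz2022, BakerWustholz2007, arXiv:1102.2273, KontsevichZagier2001
[support] the level gap one dimension down, value form, RELATIVE to one displayed transcendence
instance (replaces the dropped crux OnePeriodNeedsTwoVariables, cone repair 2026-08-15): for a real
lattice L whose least positive real period Ω₀ = L.minRealPeriod is not of the form β₀ + Σ βᵢ yᵢ with
β₀, βᵢ algebraic and exp yᵢ algebraic — the hypothesis; it is exactly the light tree fact
`Literature.NumberTheory.Transcendental.ellipticPeriod_not_mem_logSpan` at ω = Ω₀ whenever g₂(L),
g₃(L) ∈ ℚ̄, complex multiplication allowed (HuberWustholz2022 Thm 15.3(1) for [ℤ^r → 𝔾ₘ^r] × [0 →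
E]; Wüstholz 1989; BakerWustholz2007 §6.1–6.2), deliberately NOT imported so that the route's cone
holds proved facts only — and real algebraic β ≠ 0, γ, NO one-dimensional KZ-rational representation
has value γ + β·Ω₀. Together with OnePeriodInTwoVariables (Ω₀/2 is the value of a 2-dim RATIONAL
representation) and KZ's 1-dim ALGEBRAIC representation ∫ dx/√f: deg^alg(Ω₀) = 1 < deg^rat(Ω₀) = 2,
the first separation of two rational-degree strata. Proof: DimOneRationalValues writes r.value = β₀
+ Σ βᵢ yᵢ; from r.value = γ + βΩ₀ solve Ω₀ = (β₀ − γ)/β + Σ (βᵢ/β) yᵢ (`IsAlgebraic.sub/.mul/.inv`,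
`isAlgebraic_algebra -/
@[route_item "route-KontsevichZagierPeriods-HodgeLevel"]
def OnePeriodNeedsTwoVariablesOfLogSpan : Prop :=
  ∀ (L : PeriodPair), L.IsReal → (∀ (k : ℕ) (β₀ : ℂ) (β y : Fin k → ℂ), IsAlgebraic ℚ β₀ → (∀ i, IsAlgebraic ℚ (β i)) → (∀ i, IsAlgebraic ℚ (Complex.exp (y i))) → (L.minRealPeriod : ℂ) ≠ β₀ + ∑ i, β i * y i) → ∀ (β γ : ℝ), IsAlgebraic ℚ β → β ≠ 0 → IsAlgebraic ℚ γ → ∀ (r : Literature.NumberTheory.Transcendental.KZ.IntegralRep 1), r.IsRational → r.value ≠ γ + β * L.minRealPeriod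

-- `OnePeriodNeedsTwoVariablesOfLogSpan` holds: proved by `Summit.KontsevichZagierPeriods.HodgeLevel.OnePeriodNeedsTwoVariablesOfLogSpan.onePeriodNeedsTwoVariablesOfLogSpan_proof` @ 2210f89f96f8 (its module imports this route file, so no `_holds` link can be stated here).

/-- item stmt-KontsevichZagierPeriods-4992 · support · rank 9 · closed · proved by Summit.KontsevichZagierPeriods.HodgeLevel.DimOneRationalValues.dimOneRationalValues_proof @ 9a9e4a8fb10d (prover) · by planner
sources: arXiv:1102.2273, Baker1975, KontsevichZagier2001
[support] level 0 in dimension 1 (Wan's Thm 4.1 made precise; LowDimension 0405 steps (i)–(iii)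
without the moves): the value of a 1-dim KZ-rational representation is a ℚ̄-linear combination of 1
and logarithms of non-zero algebraic numbers — a ℚ-semialgebraic subset of ℝ is a finite union of
points and intervals with real algebraic endpoints, partial fractions over ℚ̄, ∫ dx/(x−a) = log,
arctan c = (1/2i)·Log((1+ic)/(1−ic)), improper ends converge only when the log terms cancel.
[difficulty: provable-now] -/
@[route_item "route-KontsevichZagierPeriods-HodgeLevel"]
def DimOneRationalValues : Prop :=
  ∀ (r : Literature.NumberTheory.Transcendental.KZ.IntegralRep 1), r.IsRational → ∃ (k : ℕ) (β₀ : ℂ) (β y : Fin k → ℂ), IsAlgebraic ℚ β₀ ∧ (∀ i, IsAlgebraic ℚ (β i)) ∧ (∀ i, IsAlgebraic ℚ (Complex.exp (y i))) ∧ (r.value : ℂ) = β₀ + ∑ i, β i * y i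

-- `DimOneRationalValues` holds: proved by `Summit.KontsevichZagierPeriods.HodgeLevel.DimOneRationalValues.dimOneRationalValues_proof` @ 9a9e4a8fb10d (its module imports this route file, so no `_holds` link can be stated here).

/-- item stmt-KontsevichZagierPeriods-4993 · support · rank 9 · open · by planner
sources: Lawden1989, KontsevichZagier2001
[support] existence side of the gap: for a real lattice with rational invariants q₂, q₃ and positive
discriminant, Ω₀/2 is the value of a 2-dim KZ-RATIONAL representation — integrand 1 over {(x, y) |
f(x) > 0, x left of the largest root, 0 < y, y²·f(x) < 1}, f = 4x³ − q₂x − q₃ (ℚ-semialgebraic; the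
largest-root condition is '∃ t > x, f t < 0', legal by the proved Tarski–Seidenberg) — by
Newton–Leibniz/Fubini and the PROVED tree fact
`PeriodPair.IsReal.integral_inv_sqrt_cubic_of_discr_pos_holds` (∫_{e₃}^{e₂} f^{−1/2} = Ω₀/2).
[difficulty: provable-now] -/
@[route_item "route-KontsevichZagierPeriods-HodgeLevel"]
def OnePeriodInTwoVariables : Prop :=
  ∀ (L : PeriodPair) (q₂ q₃ : ℚ), L.IsReal → L.g₂ = (q₂ : ℂ) → L.g₃ = (q₃ : ℂ) → 0 < (q₂ : ℝ) ^ 3 - 27 * (q₃ : ℝ) ^ 2 → ∃ (r : Literature.NumberTheory.Transcendental.KZ.IntegralRep 2), r.IsRational ∧ r.value = L.minRealPeriod / 2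

-- item stmt-KontsevichZagierPeriods-5103 · support · rank 9 · open · by planner — informal only, no Lean statement yet:
--   [support] THE LEVEL LEMMA (motivic/Hodge form; informal until a mixed-Hodge-structure-of-pairs
--   vocabulary lands — definition request MixedHodgeStructureOfPair filed with this item): for r :
--   KZ.IntegralRep n with r.IsRational (integrand p/q, q ≠ 0 on σ ⊂ ℝⁿ ℚ-semialgebraic), let X = 𝔸ⁿ ∖
--   ({q = 0} ∪ walls of a cylindrical decomposition adapted to σ) and D = the boundary configuration of
--   σ (Zariski closure of ∂σ inside X), so that value r = ⟨[p/q dx₁…dxₙ], [σ]⟩ is a period of Hⁿ(X, D)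
--   (HuberMullerStach2017 Ch. 12: naive periods are periods of pairs). CLAIM: every Gr^W-constituent of
--   the ℚ-mixed H

/-- item stmt-KontsevichZagierPeriods-4994 · assembly · rank 1 · closed · proved by Summit.KontsevichZagierPeriods.HodgeLevel.assembly_proof @ f04e676f536c (prover) · by planner
sources: KontsevichZagier2001
[assembly] RationalStrata → the sub-problem statement (d := max n m). -/
@[route_item "route-KontsevichZagierPeriods-HodgeLevel"]
def Assembly : Prop :=
  RationalStrata → KontsevichZagierPeriods

-- `Assembly` holds: proved by `Summit.KontsevichZagierPeriods.HodgeLevel.assembly_proof` @ f04e676f536c (its module imports this route file, so no `_holds` link can be stated here).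

/-! D-0027 §2.1 — DECIDING THEOREM (planner-authored via `route open/edit --closes-file`; by planner-rbadge-KontsevichZagierPeriods-HodgeLe-0777adc4-g4-0 2026-08-15T16:20:23Z):
its hypotheses are this route's items and its conclusion the sub-problem Statement (glue_lint), and it elaborates with this file. -/

@[closes "route-KontsevichZagierPeriods-HodgeLevel"] theorem closes (h : RationalStrata) : KontsevichZagierPeriods := by
  intro n m r r' hr hr' hv
  exact h (max n m) (le_max_left n m) (le_max_right n m) r r' hr hr' hv

end Summit.KontsevichZagierPeriods.KontsevichZagierPeriods.Theses.HodgeLevel
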